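/-
Copyright (c) 2026 the pub-hodgecm-mathlib formalisation cell (harness21).  Prover seat hodgecm-mathlib-K2E3-p21 (g4), Track B «K2-LIT» ∕ h413
(`stmt-HodgeConjecture-24833`), line `K2_E3_EllipticInputs`, unit U12 §L, kernel road «RICHARDSON» for (L-B_GL) at `N = 3` (road owner K2E3-p11 (g4), deal
2026-09-04T04:19Z), brick (R1c) «ONE-ORBIT UNIQUENESS FOR THE TWO NON-ZERO NILPOTENT ORBITS OF 𝔤𝔩₃(F)».  2026-09-04.
-/
import Summits.HodgeConjecture.HodgeConjecture.Theorems.K2E3GL3NilpotentOrbitSpaces         -- (R1b) (this seat): orbit spaces, docking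
import Literature.NumberTheory.Rogawski1990.LocalTransferGlue                                 -- ★ `IsLocSmooth` API (`indicator`, `add`, clopen support)
import Literature.NumberTheory.Rogawski1990.RankOneEulerPoincareGlue                          -- ★ `IsLocSmooth.const_smul ∕ sub`
import Literature.MeasureTheory.Group.InvariantFunctionalLocallyConstant                      -- ★ COINV-1 (additive form) + rider `isOpenPosMeasure_of_smulInvariantMeasure_ne_zero`
import Literature.MeasureTheory.Group.ConjClassLocallyClosedEmbedding                         -- ★ `continuousSMul_orbit`
import Literature.Topology.LocallyConstantExtend                                              -- ★ Bernstein–Zelevinsky extension, compact-open separation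
import Literature.Topology.LocallyConstantRestrictExtend                                      -- ★ `tsupport_eq_support_of_isLocallyConstant`
import Literature.Topology.Algebra.CompactOpenSubgroupOfLocallyCompact                        -- ★ van Dantzig `exists_isCompact_isOpen_subgroup`
import Literature.NumberTheory.Automorphic.GLnGelfandKazhdanInvolution                        -- ★ `t2Space_generalLinearGroup`
import Literature.NumberTheory.Automorphic.TateLocalZetaShells                                -- ★ `secondCountableTopology_localField`
import Literature.NumberTheory.GaloisRepresentations.LocalReciprocityThetaProofs              -- ★ `totallyDisconnectedSpace_of_isNonarchimedeanLocalField`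
import Mathlib.Topology.Algebra.Group.OpenMapping
import HarnessLib

/-!
# K2_E3 road (h413), §L — kernel road «RICHARDSON» for (L-B_GL) at `N = 3`, brick (R1c): uniqueness of invariant distributions on ONE non-zero nilpotent
# orbit of `𝔤𝔩₃(F)` — the regular orbit `Ad·J` (off the closed stratum `{X² = 0}`) and the minimal orbit `Ad·E₁₃` (off `0`, for `T` killed by the open stratum)

Cell `pub/hodgecm-mathlib` (D-0151), Track B, seat K2E3-p21 (g4); road owner K2E3-p11 (g4) (MEMO «ROW 11 — SPLIT ROAD» v1 §4 «RICHARDSON», deal 2026-09-04T04:19Z),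
§L lead K2E3-p12 (g4), dealer K2E3-plan (g3).  `--supports stmt-HodgeConjecture-24833 --as helper`; THEOREMS ONLY (no definition ∕ instance ∕ notation ∕ named fact ∕
`sorry`); never imports `Cruxes/…/Lines`.  COUNT-NEUTRAL ((L-B_GL) ∕ (LBGL-ge3) `sig_K2E3GLnNilpotentFourierRegularGeThree` stay OPEN).

THE STATEMENTS (the `𝔤𝔩₃` twin of ★ S2c `K2E3GL2NilpotentOneOrbitUniqueness.gl2_nilpotentUniqueness_off_zero`, Howe's one-orbit step ×2).  `F` a non-archimedean
local field, `𝔤 = Matrix (Fin 3) (Fin 3) F` with its Borel structure, `G₃ = ConjAct (GL (Fin 3) F)`, `T : (𝔤 → ℂ) → ℂ` additive, homogeneous and `Ad(GL₃(F))`-invariant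
on `C_c^∞(𝔤)` (clauses (i)–(iii) of (L-B_GL), (LBGL-ge3) :635 tokens at `N = 3`), and `ν` a NON-ZERO `G₃`-INVARIANT measure on the orbit, finite on compacta — a
HYPOTHESIS here (the Richardson measures of (R2) dock through ★ (R1b) `smulInvariantMeasure_comap_val` ∕ `comap_val_ne_zero` ∕ `integral_comp_val_comap_val`).
* `uniqueness_on_orbit` — THE GENERIC ONE-ORBIT STEP: for ANY base point `X₀` with LOCALLY CLOSED orbit `𝒪 = Ad·X₀`, an `Ad`-stable CLOSED set `Z` disjoint from
  `𝒪` with `closure 𝒪 ⊆ 𝒪 ∪ Z`, and `T` vanishing on the test functions that vanish on `𝒪` and have support disjoint from `Z`: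
  `∃ c, ∀ f ∈ C_c^∞(𝔤)`, `tsupport f ∩ Z = ∅ → T f = c · ∫_𝒪 f∘val dν`;
* **`gl3_nilpotentUniqueness_nilpReg`** (`X₀ = J`, `Z = {X² = 0} = Ad·E₁₃ ∪ {0}`, vanishing from clause (iv) «no nilpotent in the support»):
  `∃ c, ∀ f, IsLocSmooth f → (∀ X ∈ tsupport f, X * X ≠ 0) → T f = c · ∫ f∘val dν_J`;
* **`gl3_nilpotentUniqueness_nilpMin`** (`X₀ = E₁₃`, `Z = {0}`, for `T` KILLED BY THE OPEN STRATUM: `T f = 0` whenever `∀ X ∈ tsupport f, X * X ≠ 0`):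
  `∃ c, ∀ f, IsLocSmooth f → 0 ∉ tsupport f → T f = c · ∫ f∘val dν_E`.
With (R2) (Richardson measures `ν_J, ν_E` and their Radon extensions to `𝔤`) and ★ p856851's `apply_eq_delta_add_of_eq_off_point` these give (R1d)
`J(𝒩)(𝔤𝔩₃(F)) = ℂδ₀ ⊕ ℂν_E ⊕ ℂν_J` (HC Thm. 3.9 ∕ Cor. 3.10: `dim J(𝒩)` = number of nilpotent orbits = 3).

THE PROOF (Howe ∕ Harish-Chandra, as in ★ S2c).  `𝒪` is locally compact and Baire; `G₃` (σ-compact, totally disconnected, locally compact, topologised as `GL₃(F)`)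
acts continuously and transitively with OPEN orbit maps (Mathlib `isOpenMap_smul_of_sigmaCompact`); `ν` is invariant, finite on compacta, positive on opens (★
rider).  §1: every `φ ∈ S(𝒪)` extends to `Φ ∈ C_c^∞(𝔤)` with `tsupport Φ ∩ Z = ∅` (★ Bernstein–Zelevinsky extension, cut off by a compact open `Λ ⊇ val(tsupport φ)`
inside the open `Zᶜ`, ★ `exists_isCompact_isOpen_superset_subset`), two such extensions have the same `T`-value (their difference vanishes on `𝒪` with support
off `Z`), so `T̄ φ := T Φ` is a well-defined additive homogeneous invariant functional on `S(𝒪)` and ★ COINV-1 gives `T̄ = c·ν`; a test function `f` with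
`tsupport f ∩ Z = ∅` is its own extension of `f∘val ∈ S(𝒪)` (compact support since `tsupport f ∩ closure 𝒪 = tsupport f ∩ 𝒪`).
[HarishChandra1999AdmissibleDistributions, §3 Thm. 3.9, Cor. 3.10 p. 10]; [Howe1974, Prop. 2]; [BernsteinZelevinsky1976, Prop. 1.8, §1.18].

HONEST LABEL: HC_CM is proved only modulo the 7 printed citations (2 remaining named inputs: hLiu418 = stmt-HodgeConjecture-24832, h413 = stmt-HodgeConjecture-24833)
until rung 0 closes; count-neutral helper.

References: [HarishChandra1999AdmissibleDistributions] Harish-Chandra (DeBacker–Sally), AMS ULECT 16 (1999), §3 pp. 8–10, Thm. 3.9, Cor. 3.10 · [Howe1974] R. Howe,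
Math. Ann. 208 (1974), Prop. 2 · [BernsteinZelevinsky1976] Russian Math. Surveys 31:3 (1976), Prop. 1.8, §1.18.
-/

set_option autoImplicit false
set_option linter.dupNamespace false   -- `Summit.HodgeConjecture.HodgeConjecture.…` (D-0017 nested layout; lakefile exemption for Summits)

noncomputable section

open MeasureTheory Measure Filter Topology TopologicalSpace
open scoped MatrixGroups NNReal ENNReal
open Literature.NumberTheory.Rogawski1990 Literature.NumberTheory.Automorphic
open Literature.NumberTheory.GaloisRepresentations Literature.NumberTheory.GaloisRepresentations.IsNonarchimedeanLocalField
open Summit.HodgeConjecture.HodgeConjecture.Cruxes.H413.K2E3GL3NilpotentOrbits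
open Summit.HodgeConjecture.HodgeConjecture.Cruxes.H413.K2E3GL3NilpotentOrbitSpaces

namespace Summit.HodgeConjecture.HodgeConjecture.Cruxes.H413.K2E3GL3NilpotentOrbitUniqueness

variable {F : Type*} [Field F] [ValuativeRel F] [TopologicalSpace F] [IsNonarchimedeanLocalField F]

/-! ## §1  Test functions on `𝔤𝔩₃(F)` with support off `Z` versus test functions on a locally closed orbit `𝒪` with `closure 𝒪 ⊆ 𝒪 ∪ Z` -/

/-- `tsupport f ∩ Z = ∅` iff `f` vanishes near every point of `Z`. [folklore] -/
theorem disjoint_tsupport_iff {M : Type*} [TopologicalSpace M] {f : M → ℂ} {Z : Set M} :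
    Disjoint (tsupport f) Z ↔ ∀ z ∈ Z, f =ᶠ[𝓝 z] 0 := by
  rw [Set.disjoint_right]
  exact forall₂_congr fun z _ => notMem_tsupport_iff_eventuallyEq

omit [ValuativeRel F] [IsNonarchimedeanLocalField F] in
/-- **Restriction.**  For `f ∈ C_c^∞(𝔤𝔩₃(F))` with `tsupport f ∩ Z = ∅`, the restriction `f ∘ val` to an orbit `𝒪` with `closure 𝒪 ⊆ 𝒪 ∪ Z` has compact support
(`val(val⁻¹(tsupport f)) = tsupport f ∩ closure 𝒪` is compact). [cite: BernsteinZelevinsky1976, §1.1] [cite: HarishChandra1999AdmissibleDistributions, §3 p. 10] -/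
theorem hasCompactSupport_comp_val [T2Space F] {X₀ : Matrix (Fin 3) (Fin 3) F} {Z : Set (Matrix (Fin 3) (Fin 3) F)}
    (hcl : closure (MulAction.orbit (ConjAct (GL (Fin 3) F)) X₀) ⊆ MulAction.orbit (ConjAct (GL (Fin 3) F)) X₀ ∪ Z)
    {f : Matrix (Fin 3) (Fin 3) F → ℂ} (hf : IsLocSmooth f) (hfZ : Disjoint (tsupport f) Z) :
    HasCompactSupport fun x : ↥(MulAction.orbit (ConjAct (GL (Fin 3) F)) X₀) => f (x : Matrix (Fin 3) (Fin 3) F) := by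
  have hc : IsCompact ((Subtype.val : ↥(MulAction.orbit (ConjAct (GL (Fin 3) F)) X₀) → Matrix (Fin 3) (Fin 3) F) ⁻¹' tsupport f) := by
    rw [Subtype.isCompact_iff]
    have heq : (Subtype.val : ↥(MulAction.orbit (ConjAct (GL (Fin 3) F)) X₀) → Matrix (Fin 3) (Fin 3) F) ''
        ((Subtype.val : ↥(MulAction.orbit (ConjAct (GL (Fin 3) F)) X₀) → Matrix (Fin 3) (Fin 3) F) ⁻¹' tsupport f) =
        tsupport f ∩ closure (MulAction.orbit (ConjAct (GL (Fin 3) F)) X₀) := by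
      rw [Set.image_preimage_eq_inter_range, Subtype.range_coe]
      apply Set.Subset.antisymm
      · exact Set.inter_subset_inter_right _ subset_closure
      · rintro X ⟨hX, hXc⟩
        refine ⟨hX, ?_⟩
        rcases hcl hXc with h | h
        · exact h
        · exact absurd h (Set.disjoint_left.1 hfZ hX)
    rw [heq]
    exact hf.2.inter_right isClosed_closure
  exact HasCompactSupport.of_support_subset_isCompact hc fun x hx => subset_tsupport f hx

/-- **Extension off `Z`.**  Every locally constant compactly supported `φ` on an orbit `𝒪` disjoint from the CLOSED set `Z` extends to `Φ ∈ C_c^∞(𝔤𝔩₃(F))` with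
`Φ ∘ val = φ` AND `tsupport Φ ∩ Z = ∅`: extend by ★ `Literature.Topology.exists_isLocallyConstant_hasCompactSupport_extend` (Bernstein–Zelevinsky Prop. 1.8), then
multiply by the indicator of a compact open `Λ` with `val(tsupport φ) ⊆ Λ ⊆ Zᶜ` (★ `exists_isCompact_isOpen_superset_subset`). [cite: BernsteinZelevinsky1976, Prop. 1.8]
[cite: HarishChandra1999AdmissibleDistributions, §3 p. 10] -/
theorem exists_isLocSmooth_extend_disjoint {X₀ : Matrix (Fin 3) (Fin 3) F} {Z : Set (Matrix (Fin 3) (Fin 3) F)} (hZ : IsClosed Z)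
    (hOZ : Disjoint (MulAction.orbit (ConjAct (GL (Fin 3) F)) X₀ : Set (Matrix (Fin 3) (Fin 3) F)) Z)
    (φ : ↥(MulAction.orbit (ConjAct (GL (Fin 3) F)) X₀) → ℂ) (hφ : IsLocallyConstant φ) (hφs : HasCompactSupport φ) :
    ∃ Φ : Matrix (Fin 3) (Fin 3) F → ℂ, IsLocSmooth Φ ∧ Disjoint (tsupport Φ) Z ∧
      ∀ x : ↥(MulAction.orbit (ConjAct (GL (Fin 3) F)) X₀), Φ (x : Matrix (Fin 3) (Fin 3) F) = φ x := by
  haveI : T2Space F := (isLocalField F).toT2Space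
  haveI : LocallyCompactSpace F := (isLocalField F).toLocallyCompactSpace
  haveI : LocallyCompactSpace (Matrix (Fin 3) (Fin 3) F) := Pi.locallyCompactSpace_of_finite
  haveI : TotallyDisconnectedSpace F := totallyDisconnectedSpace_of_isNonarchimedeanLocalField F
  haveI : TotallyDisconnectedSpace (Matrix (Fin 3) (Fin 3) F) := inferInstanceAs (TotallyDisconnectedSpace (Fin 3 → Fin 3 → F))
  obtain ⟨Φ₀, hΦ₀, hΦ₀s, hΦ₀φ⟩ := Literature.Topology.exists_isLocallyConstant_hasCompactSupport_extend hφ hφs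
  -- the compact set `K = val(tsupport φ) ⊆ 𝒪 ⊆ Zᶜ`
  have hKc : IsCompact ((Subtype.val : ↥(MulAction.orbit (ConjAct (GL (Fin 3) F)) X₀) → Matrix (Fin 3) (Fin 3) F) '' tsupport φ) :=
    hφs.isCompact.image continuous_subtype_val
  have hKZ : (Subtype.val : ↥(MulAction.orbit (ConjAct (GL (Fin 3) F)) X₀) → Matrix (Fin 3) (Fin 3) F) '' tsupport φ ⊆ Zᶜ := by
    rintro _ ⟨x, -, rfl⟩
    exact Set.disjoint_left.1 hOZ x.2
  -- a compact open `Λ` with `K ⊆ Λ ⊆ Zᶜ`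
  obtain ⟨Λ, hΛc, hΛo, hKΛ, hΛZ⟩ := Literature.Topology.exists_isCompact_isOpen_superset_subset hKc hZ.isOpen_compl hKZ
  refine ⟨Λ.indicator Φ₀, IsLocSmooth.indicator ⟨hΦ₀, hΦ₀s⟩ ⟨hΛc.isClosed, hΛo⟩, ?_, fun x => ?_⟩
  · have hsub : tsupport (Λ.indicator Φ₀) ⊆ Λ := (closure_mono Set.support_indicator_subset).trans hΛc.isClosed.closure_subset
    exact Set.disjoint_left.2 fun Y hY hYZ => hΛZ (hsub hY) hYZ
  · by_cases hx : (x : Matrix (Fin 3) (Fin 3) F) ∈ Λ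
    · rw [Set.indicator_of_mem hx, hΦ₀φ x]
    · rw [Set.indicator_of_notMem hx]
      symm
      exact image_eq_zero_of_notMem_tsupport fun hxs => hx (hKΛ ⟨x, hxs, rfl⟩)

omit [ValuativeRel F] [IsNonarchimedeanLocalField F] in
/-- **Two extensions off `Z` of the same `φ ∈ S(𝒪)` have the same `T`-value**, for `T` additive and vanishing on the test functions that vanish on `𝒪` with support
off `Z` (their difference is such a function). [cite: HarishChandra1999AdmissibleDistributions, §3 p. 10] -/
theorem apply_eq_apply_of_forall_comp_val_eq {X₀ : Matrix (Fin 3) (Fin 3) F} {Z : Set (Matrix (Fin 3) (Fin 3) F)} {T : (Matrix (Fin 3) (Fin 3) F → ℂ) → ℂ}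
    (hT1 : ∀ f₁ f₂ : Matrix (Fin 3) (Fin 3) F → ℂ, IsLocSmooth f₁ → IsLocSmooth f₂ → T (f₁ + f₂) = T f₁ + T f₂)
    (hTZ : ∀ f : Matrix (Fin 3) (Fin 3) F → ℂ, IsLocSmooth f → (∀ x : ↥(MulAction.orbit (ConjAct (GL (Fin 3) F)) X₀), f (x : Matrix (Fin 3) (Fin 3) F) = 0) →
      Disjoint (tsupport f) Z → T f = 0)
    {Φ₁ Φ₂ : Matrix (Fin 3) (Fin 3) F → ℂ} (h₁ : IsLocSmooth Φ₁) (h₂ : IsLocSmooth Φ₂) (h₁Z : Disjoint (tsupport Φ₁) Z) (h₂Z : Disjoint (tsupport Φ₂) Z)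
    (h : ∀ x : ↥(MulAction.orbit (ConjAct (GL (Fin 3) F)) X₀), Φ₁ (x : Matrix (Fin 3) (Fin 3) F) = Φ₂ (x : Matrix (Fin 3) (Fin 3) F)) :
    T Φ₁ = T Φ₂ := by
  have hZ : Disjoint (tsupport (Φ₁ - Φ₂)) Z := by
    rw [disjoint_tsupport_iff] at h₁Z h₂Z ⊢
    exact fun z hz => ((h₁Z z hz).and (h₂Z z hz)).mono fun Y hY => by
      simp only [Pi.sub_apply, Pi.zero_apply] at hY ⊢
      rw [hY.1, hY.2, sub_zero]
  have hD := hTZ (Φ₁ - Φ₂) (h₁.sub h₂) (fun x => by rw [Pi.sub_apply, h x, sub_self]) hZ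
  calc T Φ₁ = T (Φ₂ + (Φ₁ - Φ₂)) := by rw [add_sub_cancel]
    _ = T Φ₂ + T (Φ₁ - Φ₂) := hT1 _ _ h₂ (h₁.sub h₂)
    _ = T Φ₂ := by rw [hD, add_zero]

/-! ## §2  The generic one-orbit step -/

set_option maxHeartbeats 800000 in
/-- **UNIQUENESS OF INVARIANT DISTRIBUTIONS ON ONE LOCALLY CLOSED `Ad(GL₃(F))`-ORBIT OF `𝔤𝔩₃(F)`.**  Let `𝒪 = Ad·X₀` be locally closed, `Z ⊆ 𝔤𝔩₃(F)` closed,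
`Ad`-stable, disjoint from `𝒪`, with `closure 𝒪 ⊆ 𝒪 ∪ Z`; `ν ≠ 0` a `G₃`-invariant measure on `𝒪`, finite on compacta; `T` additive, homogeneous, `Ad(GL₃(F))`-invariant on
`C_c^∞(𝔤𝔩₃(F))` and zero on the test functions vanishing on `𝒪` whose support misses `Z`.  THEN `∃ c, ∀ f ∈ C_c^∞` with `tsupport f ∩ Z = ∅`, `T f = c · ∫_𝒪 f∘val dν`
(Howe's one-orbit step: `T̄ φ := T(extension of φ off Z)` is an invariant functional on `S(𝒪)`; ★ COINV-1).
[cite: HarishChandra1999AdmissibleDistributions, Thm. 3.9, Cor. 3.10 p. 10] [cite: Howe1974, Prop. 2] [cite: BernsteinZelevinsky1976, §1.18] -/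
theorem uniqueness_on_orbit [MeasurableSpace (Matrix (Fin 3) (Fin 3) F)] [BorelSpace (Matrix (Fin 3) (Fin 3) F)]
    (X₀ : Matrix (Fin 3) (Fin 3) F) (hO : IsLocallyClosed (MulAction.orbit (ConjAct (GL (Fin 3) F)) X₀))
    {Z : Set (Matrix (Fin 3) (Fin 3) F)} (hZ : IsClosed Z)
    (hZinv : ∀ (g : GL (Fin 3) F), ∀ X ∈ Z, (g : Matrix (Fin 3) (Fin 3) F) * X * ((g⁻¹ : GL (Fin 3) F) : Matrix (Fin 3) (Fin 3) F) ∈ Z)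
    (hOZ : Disjoint (MulAction.orbit (ConjAct (GL (Fin 3) F)) X₀ : Set (Matrix (Fin 3) (Fin 3) F)) Z)
    (hcl : closure (MulAction.orbit (ConjAct (GL (Fin 3) F)) X₀) ⊆ MulAction.orbit (ConjAct (GL (Fin 3) F)) X₀ ∪ Z)
    (ν : Measure ↥(MulAction.orbit (ConjAct (GL (Fin 3) F)) X₀)) [SMulInvariantMeasure (ConjAct (GL (Fin 3) F)) ↥(MulAction.orbit (ConjAct (GL (Fin 3) F)) X₀) ν]
    [IsFiniteMeasureOnCompacts ν] (hν : ν ≠ 0)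
    (T : (Matrix (Fin 3) (Fin 3) F → ℂ) → ℂ)
    (hT1 : ∀ f₁ f₂ : Matrix (Fin 3) (Fin 3) F → ℂ, IsLocSmooth f₁ → IsLocSmooth f₂ → T (f₁ + f₂) = T f₁ + T f₂)
    (hT2 : ∀ (a : ℂ) (f : Matrix (Fin 3) (Fin 3) F → ℂ), IsLocSmooth f → T (a • f) = a * T f)
    (hT3 : ∀ (x : GL (Fin 3) F) (f : Matrix (Fin 3) (Fin 3) F → ℂ), IsLocSmooth f →
      T (fun X => f ((x : Matrix (Fin 3) (Fin 3) F) * X * ((x⁻¹ : GL (Fin 3) F) : Matrix (Fin 3) (Fin 3) F))) = T f)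
    (hTZ : ∀ f : Matrix (Fin 3) (Fin 3) F → ℂ, IsLocSmooth f → (∀ x : ↥(MulAction.orbit (ConjAct (GL (Fin 3) F)) X₀), f (x : Matrix (Fin 3) (Fin 3) F) = 0) →
      Disjoint (tsupport f) Z → T f = 0) :
    ∃ c : ℂ, ∀ f : Matrix (Fin 3) (Fin 3) F → ℂ, IsLocSmooth f → Disjoint (tsupport f) Z →
      T f = c * ∫ x : ↥(MulAction.orbit (ConjAct (GL (Fin 3) F)) X₀), f (x : Matrix (Fin 3) (Fin 3) F) ∂ν := by
  classical
  -- topology of `F`, `𝔤𝔩₃(F)`, `GL₃(F)`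
  haveI : T2Space F := (isLocalField F).toT2Space
  haveI : LocallyCompactSpace F := (isLocalField F).toLocallyCompactSpace
  haveI : SecondCountableTopology F := secondCountableTopology_localField F
  haveI : TotallyDisconnectedSpace F := totallyDisconnectedSpace_of_isNonarchimedeanLocalField F
  haveI : LocallyCompactSpace (Matrix (Fin 3) (Fin 3) F) := Pi.locallyCompactSpace_of_finite
  haveI : SecondCountableTopology (Matrix (Fin 3) (Fin 3) F) := inferInstanceAs (SecondCountableTopology (Fin 3 → Fin 3 → F))
  haveI : TotallyDisconnectedSpace (Matrix (Fin 3) (Fin 3) F) := inferInstanceAs (TotallyDisconnectedSpace (Fin 3 → Fin 3 → F))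
  haveI : SigmaCompactSpace (Matrix (Fin 3) (Fin 3) F) := inferInstanceAs (SigmaCompactSpace (Fin 3 → Fin 3 → F))
  haveI : LocallyCompactSpace (Matrix (Fin 3) (Fin 3) F)ᵐᵒᵖ := MulOpposite.opHomeomorph.symm.isClosedEmbedding.locallyCompactSpace
  haveI : SigmaCompactSpace (Matrix (Fin 3) (Fin 3) F)ᵐᵒᵖ := MulOpposite.opHomeomorph.symm.isClosedEmbedding.sigmaCompactSpace
  haveI : TotallyDisconnectedSpace (Matrix (Fin 3) (Fin 3) F)ᵐᵒᵖ :=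
    (MulOpposite.opHomeomorph (M := Matrix (Fin 3) (Fin 3) F)).symm.isEmbedding.isTotallyDisconnected_range.1
      (isTotallyDisconnected_of_totallyDisconnectedSpace _)
  haveI : T2Space (GL (Fin 3) F) := t2Space_generalLinearGroup F 3
  haveI : LocallyCompactSpace (GL (Fin 3) F) := Units.isClosedEmbedding_embedProduct.locallyCompactSpace
  haveI : SigmaCompactSpace (GL (Fin 3) F) := Units.isClosedEmbedding_embedProduct.sigmaCompactSpace
  haveI : TotallyDisconnectedSpace (GL (Fin 3) F) :=
    Units.isEmbedding_embedProduct.isTotallyDisconnected_range.1 (isTotallyDisconnected_of_totallyDisconnectedSpace _)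
  -- the synonym `G₃ = ConjAct (GL (Fin 3) F)` as a topological group acting continuously on `𝔤𝔩₃(F)` and on the orbit
  letI : TopologicalSpace (ConjAct (GL (Fin 3) F)) := (inferInstance : TopologicalSpace (GL (Fin 3) F))
  haveI : IsTopologicalGroup (ConjAct (GL (Fin 3) F)) := (inferInstance : IsTopologicalGroup (GL (Fin 3) F))
  haveI : T2Space (ConjAct (GL (Fin 3) F)) := (inferInstance : T2Space (GL (Fin 3) F))
  haveI : LocallyCompactSpace (ConjAct (GL (Fin 3) F)) := (inferInstance : LocallyCompactSpace (GL (Fin 3) F))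
  haveI : SigmaCompactSpace (ConjAct (GL (Fin 3) F)) := (inferInstance : SigmaCompactSpace (GL (Fin 3) F))
  haveI : TotallyDisconnectedSpace (ConjAct (GL (Fin 3) F)) := (inferInstance : TotallyDisconnectedSpace (GL (Fin 3) F))
  haveI : ContinuousSMul (ConjAct (GL (Fin 3) F)) (Matrix (Fin 3) (Fin 3) F) := continuousSMul_conjAct (F := F)
  haveI : LocallyCompactSpace ↥(MulAction.orbit (ConjAct (GL (Fin 3) F)) X₀) := hO.locallyCompactSpace
  haveI : ContinuousSMul (ConjAct (GL (Fin 3) F)) ↥(MulAction.orbit (ConjAct (GL (Fin 3) F)) X₀) := Literature.MeasureTheory.Group.continuousSMul_orbit _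
  have hopen : ∀ x : ↥(MulAction.orbit (ConjAct (GL (Fin 3) F)) X₀), IsOpenMap fun g : ConjAct (GL (Fin 3) F) => g • x :=
    fun x => isOpenMap_smul_of_sigmaCompact x
  obtain ⟨K₀, hK₀o, hK₀c⟩ := Literature.Topology.Algebra.exists_isCompact_isOpen_subgroup (G := ConjAct (GL (Fin 3) F))
  haveI := Literature.MeasureTheory.Group.isOpenPosMeasure_of_smulInvariantMeasure_ne_zero (G := ConjAct (GL (Fin 3) F))
    (fun x : ↥(MulAction.orbit (ConjAct (GL (Fin 3) F)) X₀) => show Continuous fun g : ConjAct (GL (Fin 3) F) => g • x by fun_prop) ν hν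
  -- the functional `T̄` on `S(𝒪)`: `T` of an extension off `Z`
  obtain ⟨Tbar, hTbar_def⟩ : ∃ Tbar : (↥(MulAction.orbit (ConjAct (GL (Fin 3) F)) X₀) → ℂ) → ℂ,
      ∀ φ, Tbar φ = if h : IsLocallyConstant φ ∧ HasCompactSupport φ then
        T (Classical.choose (exists_isLocSmooth_extend_disjoint hZ hOZ φ h.1 h.2)) else 0 := ⟨_, fun _ => rfl⟩
  have hTbar : ∀ φ : ↥(MulAction.orbit (ConjAct (GL (Fin 3) F)) X₀) → ℂ, IsLocallyConstant φ → HasCompactSupport φ →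
      ∀ Φ : Matrix (Fin 3) (Fin 3) F → ℂ, IsLocSmooth Φ → Disjoint (tsupport Φ) Z →
      (∀ x : ↥(MulAction.orbit (ConjAct (GL (Fin 3) F)) X₀), Φ (x : Matrix (Fin 3) (Fin 3) F) = φ x) → Tbar φ = T Φ := by
    intro φ hφ hφs Φ hΦ hΦZ hΦφ
    have h : IsLocallyConstant φ ∧ HasCompactSupport φ := ⟨hφ, hφs⟩
    rw [hTbar_def, dif_pos h]
    obtain ⟨hE, hEZ, hEφ⟩ := Classical.choose_spec (exists_isLocSmooth_extend_disjoint hZ hOZ φ h.1 h.2)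
    exact apply_eq_apply_of_forall_comp_val_eq hT1 hTZ hE hΦ hEZ hΦZ fun x => by rw [hEφ, hΦφ]
  -- `T̄` is additive, homogeneous and `G₃`-invariant on `S(𝒪)`
  have hadd : ∀ φ ψ : ↥(MulAction.orbit (ConjAct (GL (Fin 3) F)) X₀) → ℂ,
      IsLocallyConstant φ → HasCompactSupport φ → IsLocallyConstant ψ → HasCompactSupport ψ → Tbar (φ + ψ) = Tbar φ + Tbar ψ := by
    intro φ ψ hφ hφs hψ hψs
    obtain ⟨Φ, hΦ, hΦZ, hΦφ⟩ := exists_isLocSmooth_extend_disjoint hZ hOZ φ hφ hφs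
    obtain ⟨Ψ, hΨ, hΨZ, hΨψ⟩ := exists_isLocSmooth_extend_disjoint hZ hOZ ψ hψ hψs
    have hZ' : Disjoint (tsupport (Φ + Ψ)) Z := by
      rw [disjoint_tsupport_iff] at hΦZ hΨZ ⊢
      exact fun z hz => ((hΦZ z hz).and (hΨZ z hz)).mono fun Y hY => by
        simp only [Pi.add_apply, Pi.zero_apply] at hY ⊢
        rw [hY.1, hY.2, add_zero]
    rw [hTbar (φ + ψ) (hφ.add hψ) (hφs.add hψs) (Φ + Ψ) (hΦ.add hΨ) hZ' (fun x => by simp only [Pi.add_apply, hΦφ, hΨψ]),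
      hTbar φ hφ hφs Φ hΦ hΦZ hΦφ, hTbar ψ hψ hψs Ψ hΨ hΨZ hΨψ]
    exact hT1 Φ Ψ hΦ hΨ
  have hsmul : ∀ (a : ℂ) (φ : ↥(MulAction.orbit (ConjAct (GL (Fin 3) F)) X₀) → ℂ),
      IsLocallyConstant φ → HasCompactSupport φ → Tbar (a • φ) = a * Tbar φ := by
    intro a φ hφ hφs
    obtain ⟨Φ, hΦ, hΦZ, hΦφ⟩ := exists_isLocSmooth_extend_disjoint hZ hOZ φ hφ hφs
    have hZ' : Disjoint (tsupport (a • Φ)) Z := by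
      rw [disjoint_tsupport_iff] at hΦZ ⊢
      exact fun z hz => (hΦZ z hz).mono fun Y hY => by
        simp only [Pi.smul_apply, Pi.zero_apply, smul_eq_mul] at hY ⊢
        rw [hY, mul_zero]
    rw [hTbar (a • φ) (hφ.comp fun z => a • z) hφs.smul_left (a • Φ) (hΦ.const_smul a) hZ' (fun x => by simp only [Pi.smul_apply, hΦφ]),
      hTbar φ hφ hφs Φ hΦ hΦZ hΦφ]
    exact hT2 a Φ hΦ
  have hinv : ∀ φ : ↥(MulAction.orbit (ConjAct (GL (Fin 3) F)) X₀) → ℂ,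
      IsLocallyConstant φ → HasCompactSupport φ → ∀ g : ConjAct (GL (Fin 3) F), Tbar (fun y => φ (g • y)) = Tbar φ := by
    intro φ hφ hφs g
    obtain ⟨Φ, hΦ, hΦZ, hΦφ⟩ := exists_isLocSmooth_extend_disjoint hZ hOZ φ hφ hφs
    -- the extension `Φ ∘ Ad(g)` of `φ ∘ (g • ·)`, still supported off the `Ad`-stable `Z`
    have hc := continuous_conj (F := F) (ConjAct.ofConjAct g)
    have hΦ' : IsLocSmooth fun Y : Matrix (Fin 3) (Fin 3) F => Φ (((ConjAct.ofConjAct g : GL (Fin 3) F) : Matrix (Fin 3) (Fin 3) F) * Y *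
        (((ConjAct.ofConjAct g)⁻¹ : GL (Fin 3) F) : Matrix (Fin 3) (Fin 3) F)) :=
      ⟨hΦ.1.comp_continuous hc, hΦ.2.comp_homeomorph (Homeomorph.smul g)⟩
    have hΦ'Z : Disjoint (tsupport fun Y : Matrix (Fin 3) (Fin 3) F =>
        Φ (((ConjAct.ofConjAct g : GL (Fin 3) F) : Matrix (Fin 3) (Fin 3) F) * Y * (((ConjAct.ofConjAct g)⁻¹ : GL (Fin 3) F) : Matrix (Fin 3) (Fin 3) F))) Z := by
      rw [disjoint_tsupport_iff] at hΦZ ⊢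
      intro z hz
      have ht : Tendsto (fun Y : Matrix (Fin 3) (Fin 3) F => ((ConjAct.ofConjAct g : GL (Fin 3) F) : Matrix (Fin 3) (Fin 3) F) * Y *
          (((ConjAct.ofConjAct g)⁻¹ : GL (Fin 3) F) : Matrix (Fin 3) (Fin 3) F)) (𝓝 z)
          (𝓝 (((ConjAct.ofConjAct g : GL (Fin 3) F) : Matrix (Fin 3) (Fin 3) F) * z * (((ConjAct.ofConjAct g)⁻¹ : GL (Fin 3) F) : Matrix (Fin 3) (Fin 3) F))) :=
        hc.tendsto z
      exact ht.eventually (hΦZ _ (hZinv (ConjAct.ofConjAct g) z hz))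
    rw [hTbar (fun y => φ (g • y)) (hφ.comp_continuous (continuous_const_smul g)) (hφs.comp_homeomorph (Homeomorph.smul g)) _ hΦ' hΦ'Z
        (fun x => by rw [← hΦφ (g • x), MulAction.orbit.coe_smul, ConjAct.units_smul_def]),
      hTbar φ hφ hφs Φ hΦ hΦZ hΦφ]
    exact hT3 (ConjAct.ofConjAct g) Φ hΦ
  -- ★ COINV-1: `T̄ = c·ν` on `S(𝒪)`
  obtain ⟨c, hc⟩ := Literature.MeasureTheory.Group.exists_forall_apply_eq_const_mul_integral_of_smul_invariant_of_additive K₀ hK₀o hK₀c hopen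
    ν Tbar hadd hsmul hinv
  refine ⟨c, fun f hf hfZ => ?_⟩
  -- transfer: `f` is its own extension of `f ∘ val ∈ S(𝒪)`
  have hφ : IsLocallyConstant fun x : ↥(MulAction.orbit (ConjAct (GL (Fin 3) F)) X₀) => f (x : Matrix (Fin 3) (Fin 3) F) :=
    hf.1.comp_continuous continuous_subtype_val
  have hφs := hasCompactSupport_comp_val hcl hf hfZ
  rw [← hTbar _ hφ hφs f hf hfZ fun _ => rfl]
  exact hc _ hφ hφs

/-! ## §3  The two non-zero nilpotent orbits of `𝔤𝔩₃(F)` -/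

/-- **(R1c, regular orbit) UNIQUENESS OFF THE CLOSED STRATUM `{X² = 0}`.**  For `ν ≠ 0` a `G₃`-invariant measure on `Ad·J` finite on compacta and every `T` with
the four `J(𝒩)` clauses of (L-B_GL) at `N = 3` — (i) additive, (ii) homogeneous, (iii) `Ad(GL₃(F))`-invariant, (iv) zero on test functions whose support meets no
nilpotent — there is `c` with `T f = c · ∫_{Ad·J} f∘val dν` for every `f ∈ C_c^∞(𝔤𝔩₃(F))` with `X² ≠ 0` on `tsupport f`.
[cite: HarishChandra1999AdmissibleDistributions, Thm. 3.9, Cor. 3.10 p. 10] [cite: Howe1974, Prop. 2] [cite: BernsteinZelevinsky1976, §1.18] -/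
theorem gl3_nilpotentUniqueness_nilpReg [MeasurableSpace (Matrix (Fin 3) (Fin 3) F)] [BorelSpace (Matrix (Fin 3) (Fin 3) F)]
    (ν : Measure ↥(MulAction.orbit (ConjAct (GL (Fin 3) F)) (!![0, 1, 0; 0, 0, 1; 0, 0, 0] : Matrix (Fin 3) (Fin 3) F)))
    [SMulInvariantMeasure (ConjAct (GL (Fin 3) F)) ↥(MulAction.orbit (ConjAct (GL (Fin 3) F)) (!![0, 1, 0; 0, 0, 1; 0, 0, 0] : Matrix (Fin 3) (Fin 3) F)) ν]
    [IsFiniteMeasureOnCompacts ν] (hν : ν ≠ 0)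
    (T : (Matrix (Fin 3) (Fin 3) F → ℂ) → ℂ)
    (hT : (∀ f₁ f₂ : Matrix (Fin 3) (Fin 3) F → ℂ, IsLocSmooth f₁ → IsLocSmooth f₂ → T (f₁ + f₂) = T f₁ + T f₂) ∧
       (∀ (a : ℂ) (f : Matrix (Fin 3) (Fin 3) F → ℂ), IsLocSmooth f → T (a • f) = a * T f) ∧
       (∀ (x : GL (Fin 3) F) (f : Matrix (Fin 3) (Fin 3) F → ℂ), IsLocSmooth f →
          T (fun X => f ((x : Matrix (Fin 3) (Fin 3) F) * X * ((x⁻¹ : GL (Fin 3) F) : Matrix (Fin 3) (Fin 3) F))) = T f) ∧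
       (∀ f : Matrix (Fin 3) (Fin 3) F → ℂ, IsLocSmooth f → (∀ X ∈ tsupport f, ¬ IsNilpotent X) → T f = 0)) :
    ∃ c : ℂ, ∀ f : Matrix (Fin 3) (Fin 3) F → ℂ, IsLocSmooth f → (∀ X ∈ tsupport f, X * X ≠ 0) →
      T f = c * ∫ x : ↥(MulAction.orbit (ConjAct (GL (Fin 3) F)) (!![0, 1, 0; 0, 0, 1; 0, 0, 0] : Matrix (Fin 3) (Fin 3) F)),
        f (x : Matrix (Fin 3) (Fin 3) F) ∂ν := by
  haveI : T2Space F := (isLocalField F).toT2Space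
  obtain ⟨hT1, hT2, hT3, hT4⟩ := hT
  -- `Z = {X² = 0}`: closed, `Ad`-stable, disjoint from `Ad·J`, and `closure (Ad·J) ⊆ 𝒩 = Ad·J ∪ Z`
  have hZinv : ∀ (g : GL (Fin 3) F), ∀ X ∈ {X : Matrix (Fin 3) (Fin 3) F | X * X = 0},
      (g : Matrix (Fin 3) (Fin 3) F) * X * ((g⁻¹ : GL (Fin 3) F) : Matrix (Fin 3) (Fin 3) F) ∈ {X : Matrix (Fin 3) (Fin 3) F | X * X = 0} :=
    fun g X hX => (conj_mul_conj_eq_zero_iff g X).2 hX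
  have hOZ : Disjoint (MulAction.orbit (ConjAct (GL (Fin 3) F)) (!![0, 1, 0; 0, 0, 1; 0, 0, 0] : Matrix (Fin 3) (Fin 3) F) : Set (Matrix (Fin 3) (Fin 3) F))
      {X | X * X = 0} := Set.disjoint_left.2 fun X hX hX2 => ((mem_orbit_nilpReg_iff X).1 hX).2 hX2
  have hcl : closure (MulAction.orbit (ConjAct (GL (Fin 3) F)) (!![0, 1, 0; 0, 0, 1; 0, 0, 0] : Matrix (Fin 3) (Fin 3) F)) ⊆
      MulAction.orbit (ConjAct (GL (Fin 3) F)) (!![0, 1, 0; 0, 0, 1; 0, 0, 0] : Matrix (Fin 3) (Fin 3) F) ∪ {X | X * X = 0} := by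
    intro X hX
    have h3 : X ^ 3 = 0 := closure_orbit_nilpReg_subset hX
    by_cases h2 : X * X = 0
    · exact Or.inr h2
    · exact Or.inl ((mem_orbit_nilpReg_iff X).2 ⟨h3, h2⟩)
  -- clause (iv) ⇒ `T` kills test functions vanishing on `Ad·J` with support off `Z` (no nilpotent in the support)
  have hTZ : ∀ f : Matrix (Fin 3) (Fin 3) F → ℂ, IsLocSmooth f →
      (∀ x : ↥(MulAction.orbit (ConjAct (GL (Fin 3) F)) (!![0, 1, 0; 0, 0, 1; 0, 0, 0] : Matrix (Fin 3) (Fin 3) F)), f (x : Matrix (Fin 3) (Fin 3) F) = 0) →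
      Disjoint (tsupport f) {X | X * X = 0} → T f = 0 := by
    intro f hf hfO hfZ
    refine hT4 f hf fun X hX hnil => ?_
    rw [Literature.Topology.tsupport_eq_support_of_isLocallyConstant hf.1, Function.mem_support] at hX
    rcases eq_zero_or_mem_orbit_of_isNilpotent hnil with h | h | h
    · exact Set.disjoint_left.1 hfZ (by rw [Literature.Topology.tsupport_eq_support_of_isLocallyConstant hf.1]; exact hX) (by rw [Set.mem_setOf_eq, h, Matrix.mul_zero])
    · exact Set.disjoint_left.1 hfZ (by rw [Literature.Topology.tsupport_eq_support_of_isLocallyConstant hf.1]; exact hX) ((mem_orbit_nilpMin_iff X).1 h).1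
    · exact hX (hfO ⟨X, h⟩)
  obtain ⟨c, hc⟩ := uniqueness_on_orbit _ (isLocallyClosed_orbit_nilpReg (F := F)) isClosed_setOf_mul_self_eq_zero hZinv hOZ hcl ν hν T hT1 hT2 hT3 hTZ
  exact ⟨c, fun f hf hf2 => hc f hf (Set.disjoint_left.2 fun X hX hX2 => hf2 X hX hX2)⟩

/-- **(R1c, minimal orbit) UNIQUENESS OFF `0` FOR `T` KILLED BY THE OPEN STRATUM.**  For `ν ≠ 0` a `G₃`-invariant measure on `Ad·E₁₃` finite on compacta and every
`T` additive, homogeneous, `Ad(GL₃(F))`-invariant with `T f = 0` whenever `X² ≠ 0` on `tsupport f` (i.e. `T` already reduced by the regular stratum), there is `c`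
with `T f = c · ∫_{Ad·E₁₃} f∘val dν` for every `f ∈ C_c^∞(𝔤𝔩₃(F))` with `0 ∉ tsupport f`.  (Clause (iv) is not needed here: a test function vanishing on `Ad·E₁₃` and
near `0` has clopen support inside `{X² ≠ 0}`.) [cite: HarishChandra1999AdmissibleDistributions, Thm. 3.9, Cor. 3.10 p. 10] [cite: Howe1974, Prop. 2]
[cite: BernsteinZelevinsky1976, §1.18] -/
theorem gl3_nilpotentUniqueness_nilpMin [MeasurableSpace (Matrix (Fin 3) (Fin 3) F)] [BorelSpace (Matrix (Fin 3) (Fin 3) F)]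
    (ν : Measure ↥(MulAction.orbit (ConjAct (GL (Fin 3) F)) (!![0, 0, 1; 0, 0, 0; 0, 0, 0] : Matrix (Fin 3) (Fin 3) F)))
    [SMulInvariantMeasure (ConjAct (GL (Fin 3) F)) ↥(MulAction.orbit (ConjAct (GL (Fin 3) F)) (!![0, 0, 1; 0, 0, 0; 0, 0, 0] : Matrix (Fin 3) (Fin 3) F)) ν]
    [IsFiniteMeasureOnCompacts ν] (hν : ν ≠ 0)
    (T : (Matrix (Fin 3) (Fin 3) F → ℂ) → ℂ)
    (hT1 : ∀ f₁ f₂ : Matrix (Fin 3) (Fin 3) F → ℂ, IsLocSmooth f₁ → IsLocSmooth f₂ → T (f₁ + f₂) = T f₁ + T f₂)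
    (hT2 : ∀ (a : ℂ) (f : Matrix (Fin 3) (Fin 3) F → ℂ), IsLocSmooth f → T (a • f) = a * T f)
    (hT3 : ∀ (x : GL (Fin 3) F) (f : Matrix (Fin 3) (Fin 3) F → ℂ), IsLocSmooth f →
      T (fun X => f ((x : Matrix (Fin 3) (Fin 3) F) * X * ((x⁻¹ : GL (Fin 3) F) : Matrix (Fin 3) (Fin 3) F))) = T f)
    (hT5 : ∀ f : Matrix (Fin 3) (Fin 3) F → ℂ, IsLocSmooth f → (∀ X ∈ tsupport f, X * X ≠ 0) → T f = 0) :
    ∃ c : ℂ, ∀ f : Matrix (Fin 3) (Fin 3) F → ℂ, IsLocSmooth f → (0 : Matrix (Fin 3) (Fin 3) F) ∉ tsupport f →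
      T f = c * ∫ x : ↥(MulAction.orbit (ConjAct (GL (Fin 3) F)) (!![0, 0, 1; 0, 0, 0; 0, 0, 0] : Matrix (Fin 3) (Fin 3) F)),
        f (x : Matrix (Fin 3) (Fin 3) F) ∂ν := by
  haveI : T2Space F := (isLocalField F).toT2Space
  -- `Z = {0}`: closed, `Ad`-stable, disjoint from `Ad·E`, and `closure (Ad·E) ⊆ Ad·E ∪ {0}`
  have hZinv : ∀ (g : GL (Fin 3) F), ∀ X ∈ ({0} : Set (Matrix (Fin 3) (Fin 3) F)),
      (g : Matrix (Fin 3) (Fin 3) F) * X * ((g⁻¹ : GL (Fin 3) F) : Matrix (Fin 3) (Fin 3) F) ∈ ({0} : Set (Matrix (Fin 3) (Fin 3) F)) := by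
    intro g X hX
    rw [Set.mem_singleton_iff] at hX ⊢
    rw [hX, Matrix.mul_zero, Matrix.zero_mul]
  have hOZ : Disjoint (MulAction.orbit (ConjAct (GL (Fin 3) F)) (!![0, 0, 1; 0, 0, 0; 0, 0, 0] : Matrix (Fin 3) (Fin 3) F) : Set (Matrix (Fin 3) (Fin 3) F))
      {0} := Set.disjoint_singleton_right.2 zero_notMem_orbits.1
  -- `T` kills test functions vanishing on `Ad·E` with support off `0`: their (clopen) support lies in `{X² ≠ 0}`
  have hTZ : ∀ f : Matrix (Fin 3) (Fin 3) F → ℂ, IsLocSmooth f →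
      (∀ x : ↥(MulAction.orbit (ConjAct (GL (Fin 3) F)) (!![0, 0, 1; 0, 0, 0; 0, 0, 0] : Matrix (Fin 3) (Fin 3) F)), f (x : Matrix (Fin 3) (Fin 3) F) = 0) →
      Disjoint (tsupport f) {0} → T f = 0 := by
    intro f hf hfO hf0
    refine hT5 f hf fun X hX hX2 => ?_
    rw [Literature.Topology.tsupport_eq_support_of_isLocallyConstant hf.1, Function.mem_support] at hX
    by_cases h0 : X = 0
    · exact Set.disjoint_left.1 hf0 (by rw [Literature.Topology.tsupport_eq_support_of_isLocallyConstant hf.1]; exact hX) h0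
    · exact hX (hfO ⟨X, (mem_orbit_nilpMin_iff X).2 ⟨hX2, h0⟩⟩)
  obtain ⟨c, hc⟩ := uniqueness_on_orbit _ (isLocallyClosed_orbit_nilpMin (F := F)) isClosed_singleton hZinv hOZ closure_orbit_nilpMin_subset ν hν T
    hT1 hT2 hT3 hTZ
  exact ⟨c, fun f hf hf0 => hc f hf (Set.disjoint_singleton_right.2 hf0)⟩

end Summit.HodgeConjecture.HodgeConjecture.Cruxes.H413.K2E3GL3NilpotentOrbitUniqueness

end
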